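import Summits.AnomalousDissipation.AnomalousDissipation.Theorems.MomentParityQuarticGateCubicAssemblyTensor
import Summits.AnomalousDissipation.AnomalousDissipation.Theorems.MomentParityQuarticGateCubicComplexifyTwist

/-!
# Cubic assembly for the axial Casimir stub (line `axis-sectors` of crux `MomentParity.QuarticGate`), III:
# `cores ⇒ stub_noAxialCubicCasimir`

`noAxialCubicCasimir_of_cores`: the two combinatorial CORES (centre sector `θ = 0`, off-centre axial
sectors `θ = (0, m, 0)`, `m ≠ 0`; stated verbatim as hypotheses) — "a symmetric, transversal tensor
supported on the triads of the punctured ball `0 < |k|² ≤ M`, `25 ≤ M`, summing to `θ` and satisfying the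
quartet identities vanishes against transversal triples" — imply the stub `stub_noAxialCubicCasimir` of the
line, frequently in `N` (indeed for all `N ≥ 5`, `M = N²`). Route (all landed): Casimir clause ⇒
complexified Casimir expression `≡ 0` on complex transversal families (`…CubicComplexifyMain`) ⇒ quartet
identities for the sector tensors `Γ_θ` of the cubic coefficient tensor (`…CubicAssemblyQuartet`); shear
invariance (`AxialObs`) ⇒ twist invariance of the complexified observable (`…CubicComplexifyTwist`) ⇒
`H_L`-average: `F(c) = Σ_{axial sectors} Σ Γ̃ c c c` (`…CubicAssemblyTensor`); the cores kill every axial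
sector term (here: `gamma_symm₁/₂`, `gamma_supp`, `gamma_transversal`, `sector_term_eq_zero_of_core`), so
`F(coef u) = 0`, i.e. `P((u, g)) = 0` on level-`N` fields.
-/

namespace Summit.AnomalousDissipation.AnomalousDissipation.Theorems.MomentParityQuarticGate

open MeasureTheory Filter
open scoped InnerProductSpace RealInnerProductSpace ComplexConjugate ENNReal
open Literature.Analysis.FunctionSpaces Literature.Analysis.FluidPDE
open Summit.AnomalousDissipation.AnomalousDissipation.Theses.MomentParity
open Summit.AnomalousDissipation.AnomalousDissipation.Theorems.QuarticGate.Negative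

-- `Summit.<Summit>.<Problem>` is the tree's mandated summit-side namespace (CONVENTIONS §2); for this
-- single-conjunct summit the two coincide, so the duplicate is deliberate.
set_option linter.dupNamespace false

noncomputable section

/-! ## The sector tensors satisfy the structural hypotheses of the cores -/

section Gamma

variable {N m : ℕ} (v : Fin m → (Fin 3 → ℤ) → EuclideanSpace ℂ (Fin 3)) (H : Fin m → Fin m → Fin m → ℂ)
  (θ : Fin 3 → ℤ)

/-- Symmetry of `Γ_θ` under swapping the first two slots (`H` symmetric in its first two indices). [folklore] -/
theorem gamma_symm₁ (hH : ∀ i j l, H i j l = H j i l) (p q r : Fin 3 → ℤ) (a b c : Fin 3) :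
    (if p ∈ (Torus.freqBall N).erase 0 ∧ q ∈ (Torus.freqBall N).erase 0 ∧ r ∈ (Torus.freqBall N).erase 0 ∧
          p + q + r = θ then (1 / 6 : ℂ) * ∑ i, ∑ j, ∑ l, H i j l * v i (-p) a * v j (-q) b * v l (-r) c else 0) =
      (if q ∈ (Torus.freqBall N).erase 0 ∧ p ∈ (Torus.freqBall N).erase 0 ∧ r ∈ (Torus.freqBall N).erase 0 ∧
          q + p + r = θ then (1 / 6 : ℂ) * ∑ i, ∑ j, ∑ l, H i j l * v i (-q) b * v j (-p) a * v l (-r) c else 0) := by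
  have hc : (p ∈ (Torus.freqBall N).erase 0 ∧ q ∈ (Torus.freqBall N).erase 0 ∧ r ∈ (Torus.freqBall N).erase 0 ∧
      p + q + r = θ) ↔ (q ∈ (Torus.freqBall N).erase 0 ∧ p ∈ (Torus.freqBall N).erase 0 ∧
        r ∈ (Torus.freqBall N).erase 0 ∧ q + p + r = θ) := by
    rw [add_comm p q]; tauto
  by_cases h : p ∈ (Torus.freqBall N).erase 0 ∧ q ∈ (Torus.freqBall N).erase 0 ∧ r ∈ (Torus.freqBall N).erase 0 ∧
      p + q + r = θ
  · rw [if_pos h, if_pos (hc.1 h)]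
    congr 1
    rw [Finset.sum_comm]
    exact Finset.sum_congr rfl fun j _ => Finset.sum_congr rfl fun i _ => Finset.sum_congr rfl fun l _ => by
      rw [hH i j l]; ring
  · rw [if_neg h, if_neg (mt hc.2 h)]

/-- Symmetry of `Γ_θ` under swapping the last two slots (`H` symmetric in its last two indices). [folklore] -/
theorem gamma_symm₂ (hH : ∀ i j l, H i j l = H i l j) (p q r : Fin 3 → ℤ) (a b c : Fin 3) :
    (if p ∈ (Torus.freqBall N).erase 0 ∧ q ∈ (Torus.freqBall N).erase 0 ∧ r ∈ (Torus.freqBall N).erase 0 ∧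
          p + q + r = θ then (1 / 6 : ℂ) * ∑ i, ∑ j, ∑ l, H i j l * v i (-p) a * v j (-q) b * v l (-r) c else 0) =
      (if p ∈ (Torus.freqBall N).erase 0 ∧ r ∈ (Torus.freqBall N).erase 0 ∧ q ∈ (Torus.freqBall N).erase 0 ∧
          p + r + q = θ then (1 / 6 : ℂ) * ∑ i, ∑ j, ∑ l, H i j l * v i (-p) a * v j (-r) c * v l (-q) b else 0) := by
  have hc : (p ∈ (Torus.freqBall N).erase 0 ∧ q ∈ (Torus.freqBall N).erase 0 ∧ r ∈ (Torus.freqBall N).erase 0 ∧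
      p + q + r = θ) ↔ (p ∈ (Torus.freqBall N).erase 0 ∧ r ∈ (Torus.freqBall N).erase 0 ∧
        q ∈ (Torus.freqBall N).erase 0 ∧ p + r + q = θ) := by
    rw [add_right_comm p q r]; tauto
  by_cases h : p ∈ (Torus.freqBall N).erase 0 ∧ q ∈ (Torus.freqBall N).erase 0 ∧ r ∈ (Torus.freqBall N).erase 0 ∧
      p + q + r = θ
  · rw [if_pos h, if_pos (hc.1 h)]
    congr 1
    refine Finset.sum_congr rfl fun i _ => ?_
    rw [Finset.sum_comm]
    exact Finset.sum_congr rfl fun l _ => Finset.sum_congr rfl fun j _ => by rw [hH i j l]; ring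
  · rw [if_neg h, if_neg (mt hc.2 h)]

/-- Support of `Γ_θ`. [folklore] -/
theorem gamma_supp (p q r : Fin 3 → ℤ)
    (h : p ∉ (Torus.freqBall N).erase 0 ∨ q ∉ (Torus.freqBall N).erase 0 ∨ r ∉ (Torus.freqBall N).erase 0 ∨ p + q + r ≠ θ)
    (a b c : Fin 3) :
    (if p ∈ (Torus.freqBall N).erase 0 ∧ q ∈ (Torus.freqBall N).erase 0 ∧ r ∈ (Torus.freqBall N).erase 0 ∧
          p + q + r = θ then (1 / 6 : ℂ) * ∑ i, ∑ j, ∑ l, H i j l * v i (-p) a * v j (-q) b * v l (-r) c else 0) = 0 := by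
  rw [if_neg]
  tauto

/-- Transversality of `Γ_θ` in its first slot (transversal test families). [folklore] -/
theorem gamma_transversal (hv : ∀ (j : Fin m) (k : Fin 3 → ℤ), ∑ a, (k a : ℂ) * v j k a = 0)
    (p q r : Fin 3 → ℤ) (b c : Fin 3) :
    ∑ a, (if p ∈ (Torus.freqBall N).erase 0 ∧ q ∈ (Torus.freqBall N).erase 0 ∧ r ∈ (Torus.freqBall N).erase 0 ∧
          p + q + r = θ then (1 / 6 : ℂ) * ∑ i, ∑ j, ∑ l, H i j l * v i (-p) a * v j (-q) b * v l (-r) c else 0) *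
      (p a : ℂ) = 0 := by
  split_ifs with h
  · have hvp : ∀ i, ∑ a, v i (-p) a * (p a : ℂ) = 0 := fun i => by
      have h0 := hv i (-p)
      simp only [Pi.neg_apply, Int.cast_neg, neg_mul, Finset.sum_neg_distrib, neg_eq_zero] at h0
      rw [← h0]
      exact Finset.sum_congr rfl fun a _ => mul_comm _ _
    have e : ∀ a, (1 / 6 : ℂ) * (∑ i, ∑ j, ∑ l, H i j l * v i (-p) a * v j (-q) b * v l (-r) c) * (p a : ℂ) =
        ∑ i, ∑ j, ∑ l, (1 / 6 : ℂ) * H i j l * v j (-q) b * v l (-r) c * (v i (-p) a * (p a : ℂ)) := fun a => by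
      rw [Finset.mul_sum, Finset.sum_mul]
      refine Finset.sum_congr rfl fun i _ => ?_
      rw [Finset.mul_sum, Finset.sum_mul]
      refine Finset.sum_congr rfl fun j _ => ?_
      rw [Finset.mul_sum, Finset.sum_mul]
      exact Finset.sum_congr rfl fun l _ => by ring
    simp_rw [e]
    rw [Finset.sum_comm]
    refine Finset.sum_eq_zero fun i _ => ?_
    rw [Finset.sum_comm]
    refine Finset.sum_eq_zero fun j _ => ?_
    rw [Finset.sum_comm]
    refine Finset.sum_eq_zero fun l _ => ?_
    rw [← Finset.mul_sum, hvp i, mul_zero]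
  · simp

end Gamma

/-! ## The assembly -/

section Assembly

/-- Membership in the punctured ball in the cores' form: `k ∈ S* ↔ 0 < |k|² ≤ N²`. [folklore] -/
theorem mem_erase_freqBall_iff (N : ℕ) (k : Fin 3 → ℤ) :
    k ∈ (Torus.freqBall N).erase 0 ↔ 0 < Torus.freqNormSq k ∧ Torus.freqNormSq k ≤ ((N ^ 2 : ℕ) : ℝ) := by
  rw [Finset.mem_erase, Torus.mem_freqBall]
  push_cast
  constructor
  · rintro ⟨hk, hle⟩
    refine ⟨?_, hle⟩
    obtain ⟨i, hi⟩ : ∃ i, k i ≠ 0 := by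
      by_contra hall
      push Not at hall
      exact hk (funext hall)
    have h1 : (0 : ℝ) < (k i : ℝ) ^ 2 := by positivity
    exact lt_of_lt_of_le h1 (Finset.single_le_sum (f := fun j => ((k j : ℝ)) ^ 2) (fun _ _ => sq_nonneg _)
      (Finset.mem_univ i))
  · rintro ⟨hpos, hle⟩
    refine ⟨fun h0 => ?_, hle⟩
    rw [h0, Torus.freqNormSq_zero] at hpos
    exact lt_irrefl _ hpos

/-- **`cores ⇒ stub_noAxialCubicCasimir`.** The two combinatorial cores (centre and off-centre axial
sectors, verbatim) imply the stub `stub_noAxialCubicCasimir` of line `axis-sectors`: for every `N ≥ 5`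
(hence frequently), every `L > 3N`, band tests `g`, homogeneous cubic `P` that is `H_L`-shear invariant on
level-`N` fields and a Casimir of level-`N` Galerkin–Euler, `P((u, g)) = 0` for every level-`N` field `u`.
[folklore] -/
theorem noAxialCubicCasimir_of_cores
    (hC : ∀ (M : ℕ) (B : Finset (Fin 3 → ℤ)), 25 ≤ M → (∀ k, k ∈ B ↔ 0 < Literature.Analysis.FunctionSpaces.Torus.freqNormSq k ∧ Literature.Analysis.FunctionSpaces.Torus.freqNormSq k ≤ M) → ∀ Γ : (Fin 3 → ℤ) → (Fin 3 → ℤ) → (Fin 3 → ℤ) → Fin 3 → Fin 3 → Fin 3 → ℂ, (∀ p q r a b c, Γ p q r a b c = Γ q p r b a c) → (∀ p q r a b c, Γ p q r a b c = Γ p r q a c b) → (∀ p q r, (p ∉ B ∨ q ∉ B ∨ r ∉ B ∨ p + q + r ≠ 0) → ∀ a b c, Γ p q r a b c = 0) → (∀ p q r b c, ∑ a, Γ p q r a b c * (p a : ℂ) = 0) → (∀ (w : Fin 4 → Fin 3 → ℤ) (x : Fin 4 → Fin 3 → ℂ), (∀ i, w i ∈ B) → (∀ i, ∑ a, (w i a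 : ℂ) * x i a = 0) → ∑ p ∈ (Finset.univ : Finset (Fin 4 × Fin 4)).filter (fun p => p.1 < p.2), ∑ q ∈ (Finset.univ : Finset (Fin 4 × Fin 4)).filter (fun q => q.1 < q.2 ∧ q.1 ≠ p.1 ∧ q.1 ≠ p.2 ∧ q.2 ≠ p.1 ∧ q.2 ≠ p.2), ∑ a, ∑ b, ∑ c, Γ (w p.1 + w p.2) (w q.1) (w q.2) a b c * ((∑ d, x p.1 d * (w p.2 d : ℂ)) * x p.2 a + (∑ d, x p.2 d * (w p.1 d : ℂ)) * x p.1 a) * x q.1 b * x q.2 c = 0) → ∀ (p q r : Fin 3 → ℤ) (x y z : Fin 3 → ℂ), (∑ a, (p a : ℂ) * x a = 0) → (∑ b, (q b : ℂ) * y b = 0) → (∑ c, (r c : ℂ) * z c = 0) → ∑ a, ∑ b, ∑ c, Γ p q r a b c * x a * y b * z c = 0)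
    (hO : ∀ (M : ℕ) (m : ℤ) (B : Finset (Fin 3 → ℤ)), 25 ≤ M → m ≠ 0 → (∀ k, k ∈ B ↔ 0 < Literature.Analysis.FunctionSpaces.Torus.freqNormSq k ∧ Literature.Analysis.FunctionSpaces.Torus.freqNormSq k ≤ M) → ∀ Γ : (Fin 3 → ℤ) → (Fin 3 → ℤ) → (Fin 3 → ℤ) → Fin 3 → Fin 3 → Fin 3 → ℂ, (∀ p q r a b c, Γ p q r a b c = Γ q p r b a c) → (∀ p q r a b c, Γ p q r a b c = Γ p r q a c b) → (∀ p q r, (p ∉ B ∨ q ∉ B ∨ r ∉ B ∨ p + q + r ≠ fun i => if i = 1 then m else 0) → ∀ a b c, Γ p q r a b c = 0) → (∀ p q r b c, ∑ a, Γ p q r a b c * (p a : ℂ) = 0) → (∀ (w : Fin 4 → Fin 3 → ℤ) (x : Fin 4 → Fin 3 → ℂ), (∀ i, w i ∈ B) → (∀ i, ∑ a, (w i a : ℂ) * x i a = 0) → ∑ p ∈ (Finset.univ : Finset (Fin 4 × Fin 4)).filter (fun p => p.1 < p.2), ∑ q ∈ (Finset.univ : Finset (Fin 4 × Fin 4)).filter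 (fun q => q.1 < q.2 ∧ q.1 ≠ p.1 ∧ q.1 ≠ p.2 ∧ q.2 ≠ p.1 ∧ q.2 ≠ p.2), ∑ a, ∑ b, ∑ c, Γ (w p.1 + w p.2) (w q.1) (w q.2) a b c * ((∑ d, x p.1 d * (w p.2 d : ℂ)) * x p.2 a + (∑ d, x p.2 d * (w p.1 d : ℂ)) * x p.1 a) * x q.1 b * x q.2 c = 0) → ∀ (p q r : Fin 3 → ℤ) (x y z : Fin 3 → ℂ), (∑ a, (p a : ℂ) * x a = 0) → (∑ b, (q b : ℂ) * y b = 0) → (∑ c, (r c : ℂ) * z c = 0) → ∑ a, ∑ b, ∑ c, Γ p q r a b c * x a * y b * z c = 0) :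
    ∃ᶠ N in atTop, ∀ L : ℕ, 3 * N < L →
    ∀ (m : ℕ) (g : Fin m → UnitAddTorus (Fin 3) → EuclideanSpace ℝ (Fin 3))
      (P : MvPolynomial (Fin m) ℝ), (∀ i, IsBandTest N (g i)) → P.IsHomogeneous 3 →
      (∀ a : UnitAddTorus (Fin 3), a 1 = 0 → L • a = 0 → ∀ u : Torus.energySpace (Fin 3), IsLevel N u →
        MvPolynomial.eval (fun j => Torus.pairing u.1 (fun x => g j (x + a))) P =
          MvPolynomial.eval (fun j => Torus.pairing u.1 (g j)) P) →
      (∀ u : Torus.energySpace (Fin 3), IsLevel N u →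
        Torus.nsGeneratorPairing (d := Fin 3) 0 0 u (polyGrad g P u) = 0) →
      ∀ u : Torus.energySpace (Fin 3), IsLevel N u →
        MvPolynomial.eval (fun j => Torus.pairing u.1 (g j)) P = 0 := by
  refine Filter.Eventually.frequently ((Filter.eventually_ge_atTop 5).mono fun N hN => ?_)
  intro L hL m g P hg hP hobs hcas u hu
  classical
  have hL0 : 0 < L := by omega
  have h25 : 25 ≤ N ^ 2 := by nlinarith
  have hmem : ∀ k : Fin 3 → ℤ, k ∈ (Torus.freqBall N).erase 0 ↔
      0 < Torus.freqNormSq k ∧ Torus.freqNormSq k ≤ ((N ^ 2 : ℕ) : ℝ) := mem_erase_freqBall_iff N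
  -- test coefficient families and the coefficient tensor
  have hv0 : ∀ j, tcoef (g j) 0 = 0 := fun j => tcoef_zero (hg j)
  have hvT : ∀ (j : Fin m) (k : Fin 3 → ℤ), ∑ a, (k a : ℂ) * tcoef (g j) k a = 0 :=
    fun j k => sum_mul_tcoef_eq_zero (hg j).1 (hg j).2.1 k
  -- (1) the Casimir clause, complexified
  have hG := casimirC_eq_zero_of_casimir g hg P hcas
  -- (2) the shear invariance, complexified
  have hF := observableC_twist_eq_of_axialObs g hg P hobs
  -- (3) the field's coefficients
  have hcT : Torus.IsTransversal ((Torus.freqBall N).erase 0) (coef u) := isTransversal_coef u _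
  have hcs : ∀ k ∉ (Torus.freqBall N).erase (0 : Fin 3 → ℤ), coef u k = 0 := hu
  -- (4) the real observable is the complexified one at `coef u`
  have hreal : ((MvPolynomial.eval (fun j => Torus.pairing u.1 (g j)) P : ℝ) : ℂ) =
      MvPolynomial.eval (fun j => ∑ k ∈ (Torus.freqBall N).erase 0, ∑ a, coef u k a * tcoef (g j) (-k) a)
        (MvPolynomial.map (algebraMap ℝ ℂ) P) := by
    rw [eval_pairing_eq_eval_coef u g hg P, ← observableC_eq_ofReal (isConjSymm_coef u) g hg P]
  suffices hF0 : MvPolynomial.eval (fun j => ∑ k ∈ (Torus.freqBall N).erase 0, ∑ a, coef u k a * tcoef (g j) (-k) a)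
      (MvPolynomial.map (algebraMap ℝ ℂ) P) = 0 by
    rw [hF0] at hreal
    exact_mod_cast hreal
  -- (5) the `H_L`-average: only axial sectors survive
  rw [observableC_eq_axial_sum hL0 hL (fun j => tcoef (g j)) hP (coef u) (fun j => hF _
    ((shearGrid_iff hL0 _).2 ⟨j, rfl⟩).1 ((shearGrid_iff hL0 _).2 ⟨j, rfl⟩).2 (coef u) hcT hcs)]
  -- (6) every axial sector term vanishes by the cores
  refine Finset.sum_eq_zero fun k hk => Finset.sum_eq_zero fun p hp => Finset.sum_eq_zero fun q hq => ?_
  split_ifs with hax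
  · -- the core's conclusion for the sector `θ = k + p + q`
    rw [one_mul]
    -- symmetric coefficient tensor
    have hH₁ : ∀ i j l, MvPolynomial.coeff 0 (MvPolynomial.pderiv i (MvPolynomial.pderiv j (MvPolynomial.pderiv l
        (MvPolynomial.map (algebraMap ℝ ℂ) P)))) = MvPolynomial.coeff 0 (MvPolynomial.pderiv j (MvPolynomial.pderiv i
          (MvPolynomial.pderiv l (MvPolynomial.map (algebraMap ℝ ℂ) P)))) :=
      fun i j l => coeff_pderiv_pderiv_pderiv_swap_left _ i j l
    have hH₂ : ∀ i j l, MvPolynomial.coeff 0 (MvPolynomial.pderiv i (MvPolynomial.pderiv j (MvPolynomial.pderiv l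
        (MvPolynomial.map (algebraMap ℝ ℂ) P)))) = MvPolynomial.coeff 0 (MvPolynomial.pderiv i (MvPolynomial.pderiv l
          (MvPolynomial.pderiv j (MvPolynomial.map (algebraMap ℝ ℂ) P)))) :=
      fun i j l => coeff_pderiv_pderiv_pderiv_swap_right _ i j l
    -- the core conclusion for a sector `θ'` with `k + p + q = θ'`
    have hcore : ∀ θ' : Fin 3 → ℤ, (θ' = 0 ∨ ∃ m' : ℤ, m' ≠ 0 ∧ θ' = fun i => if i = 1 then m' else 0) →
        k + p + q = θ' →
        ∑ a, ∑ b, ∑ c, (if k ∈ (Torus.freqBall N).erase 0 ∧ p ∈ (Torus.freqBall N).erase 0 ∧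
            q ∈ (Torus.freqBall N).erase 0 ∧ k + p + q = θ' then
              (1 / 6 : ℂ) * ∑ i, ∑ j, ∑ l, MvPolynomial.coeff 0 (MvPolynomial.pderiv i (MvPolynomial.pderiv j
                (MvPolynomial.pderiv l (MvPolynomial.map (algebraMap ℝ ℂ) P)))) *
                tcoef (g i) (-k) a * tcoef (g j) (-p) b * tcoef (g l) (-q) c else 0) *
          coef u k a * coef u p b * coef u q c = 0 := by
      intro θ' hθ' hsum
      rcases hθ' with rfl | ⟨m', hm', rfl⟩
      · exact hC (N ^ 2) ((Torus.freqBall N).erase 0) h25 hmem _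
          (fun p q r a b c => gamma_symm₁ (fun j => tcoef (g j)) _ 0 hH₁ p q r a b c)
          (fun p q r a b c => gamma_symm₂ (fun j => tcoef (g j)) _ 0 hH₂ p q r a b c)
          (fun p q r h a b c => gamma_supp (fun j => tcoef (g j)) _ 0 p q r h a b c)
          (fun p q r b c => gamma_transversal (fun j => tcoef (g j)) _ 0 hvT p q r b c)
          (fun w x hw hx => quartet_identity N (fun j => tcoef (g j)) hv0 hP hG 0 w x hw hx)
          k p q (fun a => coef u k a) (fun b => coef u p b) (fun c => coef u q c) (hcT k hk) (hcT p hp) (hcT q hq)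
      · exact hO (N ^ 2) m' ((Torus.freqBall N).erase 0) h25 hm' hmem _
          (fun p q r a b c => gamma_symm₁ (fun j => tcoef (g j)) _ _ hH₁ p q r a b c)
          (fun p q r a b c => gamma_symm₂ (fun j => tcoef (g j)) _ _ hH₂ p q r a b c)
          (fun p q r h a b c => gamma_supp (fun j => tcoef (g j)) _ _ p q r h a b c)
          (fun p q r b c => gamma_transversal (fun j => tcoef (g j)) _ _ hvT p q r b c)
          (fun w x hw hx => quartet_identity N (fun j => tcoef (g j)) hv0 hP hG _ w x hw hx)
          k p q (fun a => coef u k a) (fun b => coef u p b) (fun c => coef u q c) (hcT k hk) (hcT p hp) (hcT q hq)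
    -- the sector of `(k, p, q)`
    by_cases h0 : k + p + q = 0
    · have h := hcore 0 (Or.inl rfl) h0
      simp only [hk, hp, hq, h0, and_self, if_true] at h
      simpa [hk, hp, hq] using h
    · have hθ : k + p + q = fun i => if i = 1 then (k + p + q) 1 else 0 := by
        funext i
        fin_cases i
        · simpa using hax.1
        · simp
        · simpa using hax.2
      have hm' : (k + p + q) 1 ≠ 0 := by
        intro h1
        apply h0
        rw [hθ]
        funext i
        fin_cases i <;> simp [h1]
      have h := hcore _ (Or.inr ⟨(k + p + q) 1, hm', rfl⟩) hθ
      rw [← hθ] at h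
      simp only [hk, hp, hq, and_self, if_true] at h
      simpa [hk, hp, hq] using h
  · rw [zero_mul]

end Assembly

end

/-! ## Registered sub-goal (summary) -/

/-- **Registered sub-goal `cubicAssembly_mem_erase_freqBall_iff` (compact anchor of this file, whose main
result is `noAxialCubicCasimir_of_cores : centre core → off-centre core → stub_noAxialCubicCasimir`)**:
membership in the punctured ball in the cores' form. [folklore] -/
theorem cubicAssembly_mem_erase_freqBall_iff : ∀ (N : ℕ) (k : Fin 3 → ℤ), k ∈ (Torus.freqBall N).erase 0 ↔ 0 < Torus.freqNormSq k ∧ Torus.freqNormSq k ≤ ((N ^ 2 : ℕ) : ℝ) :=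
  fun N k => mem_erase_freqBall_iff N k

end Summit.AnomalousDissipation.AnomalousDissipation.Theorems.MomentParityQuarticGate
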